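import Summits.QuantumFields.YangMills.Theorems.BalabanUVNodesN07RadialHolCoverLift
import Literature.MathematicalPhysics.QuantumFieldTheory.Balaban1983to89.Node00.TorusCoverGaugeAveragesZdRestr
import Literature.MathematicalPhysics.QuantumFieldTheory.Balaban1983to89.B8Eq119TwistedAxialRec
import HarnessLib

/-!
# N07 [B11] ∕ N05-REC R7 — THE TWIN's AXIAL CLASS `InAxOneZ` AND NORMALISATION `Restr129Z` (dag-n05-d's R2 `B8Eq119TwistedAxialRec`, [6] (1.15)∕(1.132) and (1.29) for the
# record's centred averaging) READ BY NAME on the top-anchored cover lift: the torus block axial gauges of `M^n(U)` GIVE `InAxOneZ L k Λ (lift U)` for EVERY domain tower `Λ`,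
# and `Restr129Z L k Λ 1 (lift g)` IS «`gaugeAvgIter (loopAvgBlockOp expMeanLogSU) g j (π_j(…)) = 1` on the cells» — the `Nrm` rows of `NrmOfRecordWide` in the twin's letters

Cell `pub-ymgap`, width seat `pub-ymgap-dag-n07-w3` generation 9 (torus push-down lineage), N05-REC road item R7, rows (B-Nrm-w)∕(B-Nrm-mean) of the door plan
`HOME/pub-ymgap-dag-n07-w3/R7-DOOR-PLAN.md`, BY NAME over dag-n05-d's landed `B8Eq119TwistedAxialRec` (`InAxOneZ :236`, `Restr129Z :321`, `restr129Z_one_iff`).  `--kind proof --supports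
stmt-QuantumFields-20541 --as helper` (K0⁷; count-neutral; THEOREMS ONLY, 0 `def`).  CONSUMED BY NAME, nothing modified: FILE 41 `…N07RadialHolCoverLift` (`axialFn_avgIterZ_coverLift_eq_one_of_axialGauge`,
`axialGauge_radial_iter_iff_axialFn_avgIterZG`), FILE 40b `Node00.TorusCoverGaugeAveragesZdRestr` (`Rbar_zdBlockingZ_one_coverLift_eq_one_iff_of_small`), dag-n05-d's `B8Eq119TwistedAxialRec`.
[6] = [Balaban1985RegularSpaces]; [3] = [Balaban1985Averaging]; [I] = [Balaban1987RG1].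

WHAT IS PROVED (kernel; `SU(N)` under `ιSU`; standing range `k ≤ m + K`; NO estimate).
* ★★★ `inAxOneZ_coverLift_of_axialGauge_of_small` — on the small-field domain of the run (NODE 00's guard along `M^j(U)`, `j < k`), if every `M^n(U)`, `n < k`, is in the block axial gauge
  of the (1.7) contour system (`AxialGauge (radialContourData P n (SU N)) (M^n U)` — the rows of `NrmOfRecordWide` for `U := U^w`), then the top-anchored lift `ι∘U∘π∘(·+(Lᵏ−1)∕2·𝟙)` is in
  the twin's axial class `InAxOneZ P.L k Λ` FOR EVERY `Λ` (the torus gauge is global, so the `UnderZ` restriction is not needed).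
* ★★★ `gaugeAvgIter_eq_one_of_restr129Z_one_of_small` — on the small-field domain of the (78) families, the twin's (1.29) `Restr129Z P.L k Λ 1 (ι∘g∘π∘(·+(Lᵏ−1)∕2·𝟙))` GIVES the torus
  normalisation `gaugeAvgIter (loopAvgBlockOp expMeanLogSU) g j (π_j(y + (L^{k−j}−1)∕2·𝟙)) = 1` at every cell `y ∈ Λ_j`, `j ≤ k`; ★★ `restr129Z_one_coverLift_iff_of_small` (the equivalence).
HONEST FRAMING: count-neutral helper; by-name compositions of landed bookkeeping — nothing of [6]∕[3]∕[I] asserted or discharged; `HThm4Rec` UNDISCHARGED (caveat (C-S3-1) stands); N07 ∕ N05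
NOT discharged, N07 NOT claimable on road (β); K0⁷ ∕ K1⁹ NOT closed; counts unmoved; one finite 𝕋⁴ programme at fixed ε — R4 closes the conditional finite-𝕋⁴ rung `BalabanLadder.UV` only; the
YM mass gap (Clay) is NOT proved by any of this; nothing continuum ∕ ℝ⁴ ∕ OS.  No `def`, no `sorry`, no `instance`, no `notation`.
-/

set_option autoImplicit false

noncomputable section

open scoped Matrix.Norms.L2Operator

namespace Summit.QuantumFields.YangMills.BalabanUVNodes.N07TwinAxialRestrRows

open Literature.MathematicalPhysics.QuantumFieldTheory.Balaban1983to89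
open Literature.MathematicalPhysics.QuantumFieldTheory.Balaban1983to89.Node00
open Summit.QuantumFields.Balaban3D.Carriers
open Summit.QuantumFields.YangMills.BalabanUVNodes.N07RadialHolCoverLift
open B15Eq112TorusCover (cover)
open B14DomainGeom (Pt)
open B7Prop1Explicit (axialFn)
open B7Eq78Linearization (Rbar)
open B7SectEFLinearisationRec (zdBlockingZ)
open B8Eq119TwistedAxialRec (InAxOneZ Restr129Z restr129Z_one_iff)
open BlockAveragingZd (offZ ctrShift avgIterZ)
open ExpMeanLog (expMeanLogSU deltaSU)

variable {P : Params} (N : ℕ) [NeZero N]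

/-- ★★★ **THE TORUS BLOCK AXIAL GAUGES GIVE THE TWIN's `InAxOneZ` FOR THE LIFT, FOR EVERY DOMAIN TOWER** (standing range `k ≤ m + K`; on the small-field domain of the run): the rows
«`M^n(U)` radial-axial» (`AxialGauge (radialContourData P n (SU N)) (Averaging.iter (fun _ => blockAvg expMeanLogSU) n U)`, all `n < k`) ⟹ `InAxOneZ P.L k Λ (ι∘U∘π∘(·+(Lᵏ−1)∕2·𝟙))`.
[cite: Balaban1985RegularSpaces, (1.15) p.78, (1.132) p.99; Balaban1984PropagatorsI, (1.10) p.19; Balaban1987RG1, (0.3) p.252] -/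
theorem inAxOneZ_coverLift_of_axialGauge_of_small {k : ℕ} (hk : k ≤ P.m + P.K) (U : GaugeField P 0 (SU N))
    (hs : ∀ j, j < k → ∀ c : PBond P (j + 1),
      BlockAveraging.Small expMeanLogSU (Averaging.iter (fun _ => BlockAveraging.blockAvg expMeanLogSU) j U) c)
    (hax : ∀ n, n < k → AxialGauge (radialContourData P n (SU N)) (Averaging.iter (fun _ => BlockAveraging.blockAvg expMeanLogSU) n U))
    (Λ : ℕ → Set (Pt P.d)) :
    InAxOneZ P.L k Λ (fun x μ => ιSU N (U ⟨cover P (x + fun _ => ((ctrShift P.L k : ℕ) : ℤ)), μ⟩)) := by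
  intro j _ hjk _ _ n hnj z _ r
  exact axialFn_avgIterZ_coverLift_eq_one_of_axialGauge N hk U hs (Nat.lt_of_lt_of_le hnj hjk) (hax n (Nat.lt_of_lt_of_le hnj hjk)) z r

/-- ★★ **THE TWIN's (1.29) `Restr129Z … 1` FOR THE LIFT ↔ THE TORUS NORMALISATION ROWS ON THE CELLS** (standing range; on the small-field domain of the (78) families of `R̄^{j′}g`, `j′ < k`):
`Restr129Z P.L k Λ 1 (ι∘g∘π∘(·+(Lᵏ−1)∕2·𝟙)) ↔ ∀ j ≤ k, ∀ y ∈ Λ_j, gaugeAvgIter (loopAvgBlockOp expMeanLogSU) g j (π_j(y + (L^{k−j}−1)∕2·𝟙)) = 1`.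
[cite: Balaban1985RegularSpaces, (1.29) p.81; Balaban1985Averaging, (78)–(81) p.30; Balaban1987RG1, (0.3) p.252] -/
theorem restr129Z_one_coverLift_iff_of_small {k : ℕ} (hk : k ≤ P.m + P.K) (g : GaugeTransf P 0 (SU N))
    (hs : ∀ j, j < k → ∀ (y : Site P (j + 1)) (r : Fin P.d → Fin P.L),
      dist1 ((gaugeAvgIter (loopAvgBlockOp expMeanLogSU) g j (emb y))⁻¹ * gaugeAvgIter (loopAvgBlockOp expMeanLogSU) g j (Site.blockSite y r)) < deltaSU (Fin N))
    (Λ : ℕ → Set (Pt P.d)) :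
    Restr129Z P.L k Λ (1 : Pt P.d → Fin P.d → (MatA N)ˣ) (fun x => ιSU N (g (cover P (x + fun _ => ((ctrShift P.L k : ℕ) : ℤ))))) ↔
      ∀ j, j ≤ k → ∀ y ∈ Λ j, gaugeAvgIter (loopAvgBlockOp expMeanLogSU) g j (coverAt P j (y + fun _ => ((ctrShift P.L (k - j) : ℕ) : ℤ))) = 1 := by
  rw [restr129Z_one_iff]
  refine forall_congr' fun j => forall_congr' fun hj => forall_congr' fun y => forall_congr' fun _ => ?_
  exact Rbar_zdBlockingZ_one_coverLift_eq_one_iff_of_small N hk g hs hj y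

/-- ★★★ **THE TWIN's (1.29) GIVES THE `Nrm` ROWS**: from `Restr129Z P.L k Λ 1 (lift g)` (as the twin crown will state the normalisation of its gauge), every cell `y ∈ Λ_j`, `j ≤ k`, carries
`gaugeAvgIter (loopAvgBlockOp expMeanLogSU) g j (π_j(y + (L^{k−j}−1)∕2·𝟙)) = 1` — the normalisation row of N07's `NrmOfRecordWide` read on the torus.
[cite: Balaban1985RegularSpaces, (1.29) p.81; Balaban1985Averaging, (81) p.30; Balaban1987RG1, (0.3) p.252] -/
theorem gaugeAvgIter_eq_one_of_restr129Z_one_of_small {k : ℕ} (hk : k ≤ P.m + P.K) (g : GaugeTransf P 0 (SU N))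
    (hs : ∀ j, j < k → ∀ (y : Site P (j + 1)) (r : Fin P.d → Fin P.L),
      dist1 ((gaugeAvgIter (loopAvgBlockOp expMeanLogSU) g j (emb y))⁻¹ * gaugeAvgIter (loopAvgBlockOp expMeanLogSU) g j (Site.blockSite y r)) < deltaSU (Fin N))
    {Λ : ℕ → Set (Pt P.d)}
    (h129 : Restr129Z P.L k Λ (1 : Pt P.d → Fin P.d → (MatA N)ˣ) (fun x => ιSU N (g (cover P (x + fun _ => ((ctrShift P.L k : ℕ) : ℤ))))))
    {j : ℕ} (hj : j ≤ k) {y : Pt P.d} (hy : y ∈ Λ j) :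
    gaugeAvgIter (loopAvgBlockOp expMeanLogSU) g j (coverAt P j (y + fun _ => ((ctrShift P.L (k - j) : ℕ) : ℤ))) = 1 :=
  (restr129Z_one_coverLift_iff_of_small N hk g hs Λ).mp h129 j hj y hy

end Summit.QuantumFields.YangMills.BalabanUVNodes.N07TwinAxialRestrRows

end
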